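import Literature.AnabelianGeometry.AbsoluteAnabelian.NeukirchUchidaTransport
import Mathlib.FieldTheory.Galois.Infinite
import HarnessLib

/-!
# Neukirch–Uchida, row R0 (TRANSPORT), part 2: everything in `Γ = absoluteGaloisGroup ℚ`

Classical algebraic number theory (abc-iut cell, campaign L, GAP row G-L4d2g4-1, `plan/L4/SUBDAG-NeukirchUchida.md`
row **R0 TRANSPORT** / §INTERFACES v2, holder abc-iut-w6-d055).  Part 1 (`NeukirchUchidaTransport.lean`) built
`closureEquiv K` (`e_K`), `absGaloisFixingSubgroupEquiv K` (`ι_K` onto `K.fixingSubgroup ≤ Gal(Ω₀/ℚ)`) and the `Γ`-valued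
embedding `absGaloisToRat K`.  Here, in the sub-DAG's currency (`Γ := absoluteGaloisGroup ℚ` acting on `Ω₀` and,
pointwise, on `ValuationSubring Ω₀`; `D A := MulAction.stabilizer Γ A`):

* **`ΓK K : Subgroup Γ`** — the subgroup of `Γ` fixing `K` pointwise (Mathlib `fixingSubgroup Γ ↑K`); it is
  `K.fixingSubgroup` read in `Γ` through the tree's identity `toAlgEquiv ℚ` (`ΓK_eq_comap`, the §INTERFACES spelling),
  OPEN for `K/ℚ` finite (`isOpen_ΓK`), and the image of `absGaloisToRat K` (`range_absGaloisToRat_eq_ΓK`);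
* **`galTransport K : absoluteGaloisGroup ↥K ≃ₜ* ↥(ΓK K)`** with `((galTransport K σ : ΓK K) : Γ) = absGaloisToRat K σ`,
  hence `((galTransport K σ) : Γ) • x = e_K (σ • e_K⁻¹ x)`;
* decomposition groups: `(D_{↥K}(A.comap e_K)).map (galTransport K) = (D A).subgroupOf (ΓK K)`;
* the open-subgroup dictionary: for an OPEN `V ≤ Γ`, **`KV V := fixedField (V.map (toAlgEquiv ℚ))`** is a finite
  extension of `ℚ` inside `Ω₀` with `ΓK (KV V) = V` (infinite Galois correspondence, Mathlib `InfiniteGalois`), and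
  `KV (ΓK K) = K`.

Nothing here bears on [IUTchIII] Cor. 3.12; no side is taken.

## References
* [NeukirchSchmidtWingberg2008] Neukirch–Schmidt–Wingberg, *Cohomology of Number Fields*, (12.2.1) (one closure of `ℚ`).
* [NeukirchANT1999] J. Neukirch, *Algebraic Number Theory*, Ch. IV §1 (infinite Galois correspondence).
-/

noncomputable section

open Field IntermediateField
open scoped Pointwise

namespace Literature.AnabelianGeometry.AbsoluteAnabelian

open Literature.NumberTheory.GaloisRepresentations

namespace NeukirchUchidaProof

/-! ### `Γ_K` as a subgroup of `Γ` -/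

section GammaK

variable (K : IntermediateField ℚ (AlgebraicClosure ℚ))

/-- **`Γ_K ≤ Γ`**: the subgroup of `Γ = absoluteGaloisGroup ℚ` fixing the subfield `K ⊆ Ω₀` pointwise (Mathlib's
`fixingSubgroup` for the `Γ`-action on `Ω₀`); it is `K.fixingSubgroup = Gal(Ω₀/K)` read in `Γ` through the identity
`toAlgEquiv ℚ` (`ΓK_eq_comap`). [cite: NeukirchANT1999, Ch. IV §1] -/
def ΓK : Subgroup (absoluteGaloisGroup ℚ) :=
  fixingSubgroup (absoluteGaloisGroup ℚ) ((K : Set (AlgebraicClosure ℚ)))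

/-- Membership: `g ∈ Γ_K ↔ g` fixes `K` pointwise. [cite: NeukirchANT1999, Ch. IV §1] -/
theorem mem_ΓK_iff (g : absoluteGaloisGroup ℚ) : g ∈ ΓK K ↔ ∀ x ∈ K, g • x = x :=
  mem_fixingSubgroup_iff (absoluteGaloisGroup ℚ)

/-- `toAlgEquiv ℚ g ∈ K.fixingSubgroup ↔ g ∈ Γ_K` (same condition, read in `Gal(Ω₀/ℚ)`). [cite: NeukirchANT1999, Ch. IV §1] -/
theorem toAlgEquiv_mem_fixingSubgroup_iff (g : absoluteGaloisGroup ℚ) :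
    absoluteGaloisGroup.toAlgEquiv ℚ g ∈ K.fixingSubgroup ↔ g ∈ ΓK K :=
  (IntermediateField.mem_fixingSubgroup_iff _ _).trans (mem_ΓK_iff K g).symm

/-- The §INTERFACES spelling: `Γ_K = K.fixingSubgroup.comap (toAlgEquiv ℚ)`. [cite: NeukirchANT1999, Ch. IV §1] -/
theorem ΓK_eq_comap :
    ΓK K = K.fixingSubgroup.comap (absoluteGaloisGroup.toAlgEquiv ℚ).toMonoidHom :=
  Subgroup.ext fun g => (toAlgEquiv_mem_fixingSubgroup_iff K g).symm

/-- `Γ_K` is antitone in `K`. [cite: NeukirchANT1999, Ch. IV §1] -/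
theorem ΓK_antitone {K K' : IntermediateField ℚ (AlgebraicClosure ℚ)} (h : K ≤ K') : ΓK K' ≤ ΓK K :=
  fun g hg => (mem_ΓK_iff K g).mpr fun x hx => (mem_ΓK_iff K' g).mp hg x (h hx)

variable [FiniteDimensional ℚ K]

/-- **`Γ_K` is OPEN in `Γ`** for `K/ℚ` finite (Krull topology). [cite: NeukirchANT1999, Ch. IV §1] -/
theorem isOpen_ΓK : IsOpen (ΓK K : Set (absoluteGaloisGroup ℚ)) := by
  have h : (ΓK K : Set (absoluteGaloisGroup ℚ)) =
      absoluteGaloisGroupContinuousMulEquiv ℚ ⁻¹' (K.fixingSubgroup : Set (AlgebraicClosure ℚ ≃ₐ[ℚ] AlgebraicClosure ℚ)) :=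
    Set.ext fun g => (toAlgEquiv_mem_fixingSubgroup_iff K g).symm
  rw [h]
  exact (IntermediateField.fixingSubgroup_isOpen K).preimage (absoluteGaloisGroupContinuousMulEquiv ℚ).continuous

/-- `Γ_K` is closed in `Γ` (an open subgroup is closed). [cite: NeukirchANT1999, Ch. IV §1] -/
theorem isClosed_ΓK : IsClosed (ΓK K : Set (absoluteGaloisGroup ℚ)) :=
  (ΓK K).isClosed_of_isOpen (isOpen_ΓK K)

/-- The image of part 1's embedding `absGaloisToRat K : absoluteGaloisGroup ↥K →ₜ* Γ` is `Γ_K`.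
[cite: NeukirchSchmidtWingberg2008, Thm (12.2.1)] -/
theorem range_absGaloisToRat_eq_ΓK : (absGaloisToRat K).toMonoidHom.range = ΓK K :=
  range_absGaloisToRat K

/-- `absGaloisToRat K σ ∈ Γ_K`. [cite: NeukirchSchmidtWingberg2008, Thm (12.2.1)] -/
theorem absGaloisToRat_mem_ΓK (σ : absoluteGaloisGroup K) : absGaloisToRat K σ ∈ ΓK K := by
  rw [← range_absGaloisToRat_eq_ΓK]
  exact ⟨σ, rfl⟩

/-! ### `galTransport K : G_{↥K} ≃ₜ* Γ_K` -/

/-- **`galTransport K : absoluteGaloisGroup ↥K ≃ₜ* ↥(Γ_K)`** — the absolute Galois group of the abstract number field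
`↥K` IS the open subgroup `Γ_K ≤ Γ`, as a topological group (part 1's `absGaloisToRat K`, corestricted to its image).
[cite: NeukirchSchmidtWingberg2008, Thm (12.2.1)] -/
def galTransport : absoluteGaloisGroup K ≃ₜ* ΓK K :=
  { toFun := fun σ => ⟨absGaloisToRat K σ, absGaloisToRat_mem_ΓK K σ⟩
    invFun := fun g => (absGaloisFixingSubgroupEquiv K).symm
      ⟨absoluteGaloisGroup.toAlgEquiv ℚ (g : absoluteGaloisGroup ℚ), (toAlgEquiv_mem_fixingSubgroup_iff K _).mpr g.2⟩
    left_inv := fun σ => by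
      apply (absGaloisFixingSubgroupEquiv K).injective
      rw [ContinuousMulEquiv.apply_symm_apply]
      rfl
    right_inv := fun g => by
      apply Subtype.ext
      apply (absoluteGaloisGroup.toAlgEquiv ℚ).injective
      change absoluteGaloisGroup.toAlgEquiv ℚ (absGaloisToRat K _) = _
      rw [toAlgEquiv_absGaloisToRat, ContinuousMulEquiv.apply_symm_apply]
    map_mul' := fun σ τ => Subtype.ext (map_mul (absGaloisToRat K) σ τ)
    continuous_toFun := (absGaloisToRat K).continuous.subtype_mk _
    continuous_invFun := by
      apply (absGaloisFixingSubgroupEquiv K).symm.continuous.comp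
      exact ((absoluteGaloisGroupContinuousMulEquiv ℚ).continuous.comp continuous_subtype_val).subtype_mk _ }

/-- `galTransport` is `absGaloisToRat` corestricted: `((galTransport K σ : Γ_K) : Γ) = absGaloisToRat K σ`.
[cite: NeukirchSchmidtWingberg2008, Thm (12.2.1)] -/
@[simp] theorem coe_galTransport (σ : absoluteGaloisGroup K) :
    ((galTransport K σ : ΓK K) : absoluteGaloisGroup ℚ) = absGaloisToRat K σ := rfl

/-- **The action formula**: `((galTransport K σ) : Γ) • x = e_K (σ • e_K⁻¹ x)` for `x ∈ Ω₀`.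
[cite: NeukirchSchmidtWingberg2008, Thm (12.2.1)] -/
theorem galTransport_smul (σ : absoluteGaloisGroup K) (x : AlgebraicClosure ℚ) :
    ((galTransport K σ : ΓK K) : absoluteGaloisGroup ℚ) • x = closureEquiv K (σ • (closureEquiv K).symm x) :=
  absGaloisToRat_smul K σ x

/-- The inverse formula: `(galTransport⁻¹ g) • y = e_K⁻¹ ((g : Γ) • e_K y)` for `g ∈ Γ_K`, `y ∈ AlgebraicClosure ↥K`.
[cite: NeukirchSchmidtWingberg2008, Thm (12.2.1)] -/
theorem galTransport_symm_smul (g : ΓK K) (y : AlgebraicClosure K) :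
    (galTransport K).symm g • y = (closureEquiv K).symm ((g : absoluteGaloisGroup ℚ) • closureEquiv K y) :=
  rfl

/-- **Decomposition groups along `galTransport`**: the image of the stabiliser of the pulled-back valuation subring
`A.comap e_K` is `(D A).subgroupOf Γ_K` (`D A = MulAction.stabilizer Γ A = decompositionGroupNF ℚ A`).
[cite: NeukirchSchmidtWingberg2008, Thm (12.2.1)] -/
theorem map_stabilizer_comap_galTransport (A : ValuationSubring (AlgebraicClosure ℚ)) :
    (MulAction.stabilizer (absoluteGaloisGroup K)
        (A.comap (closureEquiv K : AlgebraicClosure K →+* AlgebraicClosure ℚ))).map (galTransport K).toMonoidHom =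
      (MulAction.stabilizer (absoluteGaloisGroup ℚ) A).subgroupOf (ΓK K) := by
  ext g
  rw [Subgroup.mem_subgroupOf, Subgroup.mem_map]
  constructor
  · rintro ⟨σ, hσ, rfl⟩
    exact (mem_stabilizer_comap_iff_absGaloisToRat_mem K A σ).mp hσ
  · intro hg
    refine ⟨(galTransport K).symm g, ?_, ?_⟩
    · rw [mem_stabilizer_comap_iff_absGaloisToRat_mem, ← coe_galTransport, ContinuousMulEquiv.apply_symm_apply]
      exact hg
    · exact (galTransport K).apply_symm_apply g

/-- The same with the tree's `decompositionGroupNF` on both sides. [cite: NeukirchSchmidtWingberg2008, Thm (12.2.1)] -/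
theorem map_decompositionGroupNF_comap_galTransport (A : ValuationSubring (AlgebraicClosure ℚ)) :
    (decompositionGroupNF K (A.comap (closureEquiv K : AlgebraicClosure K →+* AlgebraicClosure ℚ))).map
        (galTransport K).toMonoidHom =
      (decompositionGroupNF ℚ A).subgroupOf (ΓK K) :=
  map_stabilizer_comap_galTransport K A

/-- Membership form: `σ ∈ D_{↥K}(A.comap e_K) ↔ (galTransport K σ : Γ) ∈ D A`. [cite: NeukirchSchmidtWingberg2008, Thm (12.2.1)] -/
theorem mem_stabilizer_comap_iff_galTransport_mem (A : ValuationSubring (AlgebraicClosure ℚ)) (σ : absoluteGaloisGroup K) :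
    σ ∈ MulAction.stabilizer (absoluteGaloisGroup K)
        (A.comap (closureEquiv K : AlgebraicClosure K →+* AlgebraicClosure ℚ)) ↔
      ((galTransport K σ : ΓK K) : absoluteGaloisGroup ℚ) ∈ MulAction.stabilizer (absoluteGaloisGroup ℚ) A :=
  mem_stabilizer_comap_iff_absGaloisToRat_mem K A σ

end GammaK

/-! ### The open-subgroup dictionary: `V ↦ K_V`, `Γ_{K_V} = V` -/

section OpenSubgroups

-- `IsGalois ℚ Ω₀` for the instance-search `ℚ`-algebra structure on `Ω₀` is the tree's
-- `Literature.NumberTheory.GaloisRepresentations.Rat.isGalois_algebraicClosure` (ImaginaryQuadraticCyclotomicProofs.lean,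
-- a heavy import); below it is re-derived inline from Mathlib's `IsAlgClosure.isGalois` where needed (no new declaration).

/-- **`K_V`**: the subfield of `Ω₀` fixed by a subgroup `V ≤ Γ` (read in `Gal(Ω₀/ℚ)` through `toAlgEquiv ℚ`).
[cite: NeukirchANT1999, Ch. IV §1] -/
def KV (V : Subgroup (absoluteGaloisGroup ℚ)) : IntermediateField ℚ (AlgebraicClosure ℚ) :=
  IntermediateField.fixedField (V.map (absoluteGaloisGroup.toAlgEquiv ℚ).toMonoidHom)

/-- `V` fixes `K_V` pointwise: `V ≤ Γ_{K_V}`. [cite: NeukirchANT1999, Ch. IV §1] -/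
theorem le_ΓK_KV (V : Subgroup (absoluteGaloisGroup ℚ)) : V ≤ ΓK (KV V) := fun g hg =>
  (mem_ΓK_iff _ g).mpr fun x hx =>
    (IntermediateField.mem_fixedField_iff _ x).mp hx (absoluteGaloisGroup.toAlgEquiv ℚ g) ⟨g, hg, rfl⟩

/-- Membership in `V.map (toAlgEquiv ℚ)`: `toAlgEquiv ℚ g` lies in it iff `g ∈ V`. [cite: NeukirchANT1999, Ch. IV §1] -/
theorem toAlgEquiv_mem_map_iff (V : Subgroup (absoluteGaloisGroup ℚ)) (g : absoluteGaloisGroup ℚ) :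
    absoluteGaloisGroup.toAlgEquiv ℚ g ∈ V.map (absoluteGaloisGroup.toAlgEquiv ℚ).toMonoidHom ↔ g ∈ V := by
  constructor
  · rintro ⟨h, hh, hhg⟩
    have : h = g := (absoluteGaloisGroup.toAlgEquiv ℚ).injective hhg
    exact this ▸ hh
  · intro hg
    exact ⟨g, hg, rfl⟩

/-- `V.map (toAlgEquiv ℚ)` is closed in `Gal(Ω₀/ℚ)` when `V` is closed in `Γ` (the identity is a homeomorphism).
[cite: NeukirchANT1999, Ch. IV §1] -/
theorem isClosed_map_toAlgEquiv (V : Subgroup (absoluteGaloisGroup ℚ)) (hV : IsClosed (V : Set (absoluteGaloisGroup ℚ))) :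
    IsClosed ((V.map (absoluteGaloisGroup.toAlgEquiv ℚ).toMonoidHom :
      Subgroup (AlgebraicClosure ℚ ≃ₐ[ℚ] AlgebraicClosure ℚ)) : Set (AlgebraicClosure ℚ ≃ₐ[ℚ] AlgebraicClosure ℚ)) := by
  have h : ((V.map (absoluteGaloisGroup.toAlgEquiv ℚ).toMonoidHom :
      Subgroup (AlgebraicClosure ℚ ≃ₐ[ℚ] AlgebraicClosure ℚ)) : Set (AlgebraicClosure ℚ ≃ₐ[ℚ] AlgebraicClosure ℚ)) =
      (absoluteGaloisGroupContinuousMulEquiv ℚ).symm ⁻¹' (V : Set (absoluteGaloisGroup ℚ)) :=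
    Set.ext fun g => toAlgEquiv_mem_map_iff V g
  rw [h]
  exact hV.preimage (absoluteGaloisGroupContinuousMulEquiv ℚ).symm.continuous

/-- **Infinite Galois correspondence for CLOSED subgroups**: `Γ_{K_V} = V` when `V` is closed in `Γ`.
[cite: NeukirchANT1999, Ch. IV §1] -/
theorem ΓK_KV_of_isClosed (V : Subgroup (absoluteGaloisGroup ℚ)) (hV : IsClosed (V : Set (absoluteGaloisGroup ℚ))) :
    ΓK (KV V) = V := by
  haveI : IsGalois ℚ (AlgebraicClosure ℚ) :=
    @IsAlgClosure.isGalois ℚ (AlgebraicClosure ℚ) _ _ (AlgebraicClosure.instAlgebra ℚ) inferInstance inferInstance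
  let H : ClosedSubgroup (AlgebraicClosure ℚ ≃ₐ[ℚ] AlgebraicClosure ℚ) :=
    ⟨V.map (absoluteGaloisGroup.toAlgEquiv ℚ).toMonoidHom, isClosed_map_toAlgEquiv V hV⟩
  have key : (IntermediateField.fixedField (H : Subgroup (AlgebraicClosure ℚ ≃ₐ[ℚ] AlgebraicClosure ℚ))).fixingSubgroup
      = (H : Subgroup (AlgebraicClosure ℚ ≃ₐ[ℚ] AlgebraicClosure ℚ)) :=
    InfiniteGalois.fixingSubgroup_fixedField H
  refine le_antisymm (fun g hg => ?_) (le_ΓK_KV V)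
  have hg' : absoluteGaloisGroup.toAlgEquiv ℚ g ∈
      (IntermediateField.fixedField (H : Subgroup (AlgebraicClosure ℚ ≃ₐ[ℚ] AlgebraicClosure ℚ))).fixingSubgroup :=
    (toAlgEquiv_mem_fixingSubgroup_iff (KV V) g).mpr hg
  have hg'' : absoluteGaloisGroup.toAlgEquiv ℚ g ∈ (H : Subgroup (AlgebraicClosure ℚ ≃ₐ[ℚ] AlgebraicClosure ℚ)) :=
    key ▸ hg'
  exact (toAlgEquiv_mem_map_iff V g).mp hg''

/-- **`Γ_{K_V} = V` for OPEN `V`** (open subgroups are closed). [cite: NeukirchANT1999, Ch. IV §1] -/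
theorem ΓK_KV (V : Subgroup (absoluteGaloisGroup ℚ)) (hV : IsOpen (V : Set (absoluteGaloisGroup ℚ))) :
    ΓK (KV V) = V :=
  ΓK_KV_of_isClosed V (V.isClosed_of_isOpen hV)

/-- **`K_V/ℚ` is FINITE for open `V`** (infinite Galois theory: open fixing subgroup ⟺ finite subextension).
[cite: NeukirchANT1999, Ch. IV §1] -/
theorem finiteDimensional_KV (V : Subgroup (absoluteGaloisGroup ℚ)) (hV : IsOpen (V : Set (absoluteGaloisGroup ℚ))) :
    FiniteDimensional ℚ (KV V) := by
  haveI : IsGalois ℚ (AlgebraicClosure ℚ) :=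
    @IsAlgClosure.isGalois ℚ (AlgebraicClosure ℚ) _ _ (AlgebraicClosure.instAlgebra ℚ) inferInstance inferInstance
  refine (InfiniteGalois.isOpen_iff_finite (KV V)).mp ?_
  have h1 : ((KV V).fixingSubgroup : Set (AlgebraicClosure ℚ ≃ₐ[ℚ] AlgebraicClosure ℚ)) =
      (absoluteGaloisGroupContinuousMulEquiv ℚ).symm ⁻¹' (V : Set (absoluteGaloisGroup ℚ)) := by
    ext g
    exact (toAlgEquiv_mem_fixingSubgroup_iff (KV V) g).trans (by rw [ΓK_KV V hV]; exact Iff.rfl)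
  change IsOpen ((KV V).fixingSubgroup : Set (AlgebraicClosure ℚ ≃ₐ[ℚ] AlgebraicClosure ℚ))
  rw [h1]
  exact hV.preimage (absoluteGaloisGroupContinuousMulEquiv ℚ).symm.continuous

/-- **`K_{Γ_K} = K`** for `K/ℚ` finite (finite Galois correspondence `fixedField (fixingSubgroup K) = K`).
[cite: NeukirchANT1999, Ch. IV §1] -/
theorem KV_ΓK (K : IntermediateField ℚ (AlgebraicClosure ℚ)) [FiniteDimensional ℚ K] : KV (ΓK K) = K := by
  haveI : IsGalois ℚ (AlgebraicClosure ℚ) :=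
    @IsAlgClosure.isGalois ℚ (AlgebraicClosure ℚ) _ _ (AlgebraicClosure.instAlgebra ℚ) inferInstance inferInstance
  have h1 : (ΓK K).map (absoluteGaloisGroup.toAlgEquiv ℚ).toMonoidHom = K.fixingSubgroup := by
    refine Subgroup.ext fun g => ?_
    constructor
    · rintro ⟨h, hh, rfl⟩
      exact (toAlgEquiv_mem_fixingSubgroup_iff K h).mpr hh
    · intro hg
      exact ⟨(absoluteGaloisGroup.toAlgEquiv ℚ).symm g, (toAlgEquiv_mem_fixingSubgroup_iff K _).mp hg, rfl⟩
  have h2 := InfiniteGalois.fixedField_fixingSubgroup K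
  change IntermediateField.fixedField _ = K
  exact h1 ▸ h2

end OpenSubgroups

end NeukirchUchidaProof

end Literature.AnabelianGeometry.AbsoluteAnabelian

end
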